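/-
Copyright (c) 2026 the pub-hodgecm-mathlib formalisation cell (harness21).  Prover seat hodgecm-mathlib-LH4-p03 (g4): line LH4 (closer row `stub_N6nsDyadic`, germ road
«N6nsGerm» ED. 1.17 «α-odd»), organ «DYADIC ⟸ DYADIC AT `Φ₃`» (descent of the print residual to the quasi-split form); 2026-09-02.
-/
import Literature.NumberTheory.Rogawski1990.LocalTransferIdentityCoreResidualStatements   -- ★ p847938 (LH4-p01 (g0)): `N6nsDyadicStatement`; brings ★ p847670 three-way split, ★ `s3id_descent_of_formCongr`, ★ (H2) frame, ★ Godement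
import HarnessLib

/-!
# [Rogawski1990 §4.9 Prop. 4.9.1 (a) p. 55; §14.4 p. 237] [LanglandsShelstad1990Descent (2.1.2)] The DYADIC residual of the identity core DESCENDS to the
# quasi-split form `Φ₃`: «DYADIC» ⟸ «DYADIC AT `Φ₃`»

Topic `NumberTheory/Rogawski1990`; namespace `Literature.NumberTheory.Rogawski1990`.  THEOREMS ONLY (no definition, no instance, no notation, no named fact, no
`sorry`); kernel lane `--supports stmt-HodgeConjecture-24833`.  Cell `pub/hodgecm-mathlib` (D-0151), crux H413 = `stmt-HodgeConjecture-24833`; half A line LH4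
(closer `Cruxes/H413/Lines/F0_U3LettersRung1.lean`, post-ED. 39 §2‴ «α-odd-★» IN-row `stub_N6nsDyadic : N6nsDyadicStatement`; germ `F0_P3a_N6nsGerm` ED. 1.17 binder
`hdy : N6nsDyadicStatement`).  HONEST LABEL: HC_CM is proved only modulo the 7 printed citations (2 remaining named inputs: hLiu418 = stmt-HodgeConjecture-24832,
h413 = stmt-HodgeConjecture-24833) until rung 0 closes; this file is count-neutral: it NARROWS the print residual «DYADIC» ([LS₂] at `v ∣ 2` for EVERY anisotropic
hermitian `H′`) to the same statement for the QUASI-SPLIT form `Φ₃ = antidiag(1,1,1)` only; it discharges nothing by itself.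

WHAT.  `N6nsDyadicStatement` (★ `LocalTransferIdentityCoreResidualStatements`) is the identity core of local `Δ‴_v`-transfer for `(U(H′), U(1,1) × U(1))` at a
DYADIC non-split place `v`, for every CM field `L`, every hermitian anisotropic `H′ ∈ M₃(L)`, every unitary `μ` with the μ-guard, Haar measures and CANONICAL orbital
families.  THIS FILE: it suffices to know the same identity ON THE QUASI-SPLIT GROUP `U(Φ₃)(L⁺_v)` — for every Haar measure `νG₃`, every canonical family `mG₃` and every
`φ₃ ∈ C_c^∞(U(Φ₃)(L⁺_v))` (hypothesis `hdyΦ₃`, the `N6nsS3ramStatement` text with the ramification line `e(w|v) ≠ 1` and the Shalika line dropped and `2 ∈ 𝒪_w^×`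
replaced by `2 ∉ 𝒪_w^×`).  In print this is where [LS₂] is stated anyway (quasi-split `G` of type `A₂`); every in-house organ of the odd road (Howe∕Shalika package,
level pieces, hyperspecial and tame-ramified columns) is built on `placeForm Φ₃`, so an in-house dyadic road, if ever cut, targets exactly `hdyΦ₃`.

PROOF (the tame-ramified branch of ★ p847670 `n6nsS3id_of_tameRamAntidiag_of_dyadic_of_shalikaAntidiag`, verbatim at `v ∣ 2`).  At the non-split `v` pick the place
`w` (`Nonempty`), `c • w = w` (★ `smul_placesOver_eq_of_subsingleton`), `det H′ ≠ 0` (★ `Godement.det_ne_zero_of_anisotropic`); the local similitude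
`ᵗ(σT)·H′_v·T = a·Φ₃,v` exists at EVERY non-split place, dyadic or not (★ (H2) `HermitianFrame.exists_formCongr_conjLocal_eq_smul_antidiag_three`, no parity
hypothesis); DESCENT ★ `s3id_descent_of_formCongr` (canonical families transport along `e := cmDatumLocalCongr`, `Δ‴` and the orbital sums are `e`-invariant up to
`χ(a) = ±1`; no parity hypothesis) reduces the `H′`-statement to the `Φ₃`-statement for the transported data, which is `hdyΦ₃` at `(L, μ, w)` with the dyadic
hypothesis read at `w`.

* `n6nsDyadic_of_dyadicAntidiag` — «DYADIC» ⟸ «DYADIC AT `Φ₃`» (conclusion = ★ `N6nsDyadicStatement` BY NAME).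

## References
* [Rogawski1990] J. D. Rogawski, *Automorphic Representations of Unitary Groups in Three Variables*, Ann. of Math. Stud. 123 (1990): §4.9 Prop. 4.9.1 (a) p. 55
  («the existence of `f^H` in the p-adic case is contained in [LS₂]»); §4.3 (4.3.1)–(4.3.2) p. 43; §14.4 p. 237 (inner forms locally isomorphic to the quasi-split group).
* [LanglandsShelstad1990Descent] R. P. Langlands, D. Shelstad, *Descent for transfer factors*, The Grothendieck Festschrift II, Progr. Math. 87 (1990): §2.1 (2.1.2).
* [LanglandsShelstad1989] R. P. Langlands, D. Shelstad, *Orbital integrals on forms of SL(3), II*, Canad. J. Math. 41 (1989): Theorem (end of §2, p. 484) (= [LS₂]).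
* [LanglandsShelstad1987] R. P. Langlands, D. Shelstad, *On the definition of transfer factors*, Math. Ann. 278 (1987): §4.2 (transfer factors for inner twists).
-/

set_option autoImplicit false

noncomputable section

open NumberField IsDedekindDomain MeasureTheory Measure Topology Filter
open Literature.NumberTheory.Rogawski1990 Literature.NumberTheory.Automorphic Literature.NumberTheory.GaloisRepresentations
open Literature.NumberTheory.Automorphic.UnitaryGroup Literature.NumberTheory.Automorphic.IntegralReduction
open Literature.AlgebraicGeometry.ShimuraVarieties (unitaryGroup hermForm)
open scoped Matrix MatrixGroups Classical ValuativeRel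

namespace Literature.NumberTheory.Rogawski1990

/-! ## The descent of the dyadic residual to the quasi-split form -/

set_option maxHeartbeats 800000 in
-- statement-heavy: two letter-sized Prop texts (hypothesis at `Φ₃`, conclusion `N6nsDyadicStatement`)
/-- **«DYADIC» ⟸ «DYADIC AT `Φ₃`» — the dyadic residual of the identity core descends to the quasi-split form.**  HYPOTHESIS `hdyΦ₃` («DYADIC AT `Φ₃`»): for every CM
field `L`, unitary `μ` with `μ|_{𝕀_{L⁺}} = ω_{L∕L⁺}`, place `w ∣ v` with `c • w = w` and `2 ∉ 𝒪_w^×`, Borel σ-algebras, Haar measures `νH`, `νG₃`, CANONICAL families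
`mH`, `mG₃` on `H_v = U(1,1) × U(1)` and `U(Φ₃)(L⁺_v)`: every `φ₃ ∈ C_c^∞(U(Φ₃)(L⁺_v))` admits `V ∈ 𝓝 1` and `φH ∈ C_c^∞(H_v)` with
`SO_{γH}(φH) = Σ_c Δ‴_v(γH, c)·O_c(φ₃)` for all `G`-regular `γH ∈ V` (= [LS₂] for the quasi-split `U(3)` at a dyadic place).  CONCLUSION: ★ `N6nsDyadicStatement` (the
same identity for EVERY hermitian anisotropic `H′`).  Proof: frame ★ (H2) `exists_formCongr_conjLocal_eq_smul_antidiag_three` + DESCENT ★ `s3id_descent_of_formCongr`,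
both parity-free; `w` from `Nonempty`, `c • w = w` from `Subsingleton`, `det H′ ≠ 0` from anisotropy (★ Godement).
[cite: Rogawski1990, §4.9 Prop. 4.9.1 (a) p. 55; §14.4 p. 237] [cite: LanglandsShelstad1990Descent, §2.1 (2.1.2)] [cite: LanglandsShelstad1987, §4.2] -/
theorem n6nsDyadic_of_dyadicAntidiag
    (hdyΦ₃ : ∀ (L : Type) [Field L] [NumberField L] [IsCMField L] (μ : HeckeCharacter L)
      {v : HeightOneSpectrum (𝓞 ↥(maximalRealSubfield L))} (w : UnitaryGroup.PlacesOver L v)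
      (_hw : IsCMField.complexConj L • w.1 = w.1)
      (_hμu : μ.IsUnitary)
      (_hμω : ∀ x : ideleGroup ↥(maximalRealSubfield L), μ (AdeleRing.ideleBaseChange ↥(maximalRealSubfield L) L x) = quadraticHeckeCharCM L x)
      (_h2 : ¬ IsUnit (2 : 𝒪[w.1.adicCompletion L]))
      [MeasurableSpace ((UnitaryGroup.cmDatum L 3 (Matrix.of fun i j : Fin 3 => if i.val + j.val + 1 = 3 then (1 : L) else 0)).Local v)] [BorelSpace ((UnitaryGroup.cmDatum L 3 (Matrix.of fun i j : Fin 3 => if i.val + j.val + 1 = 3 then (1 : L) else 0)).Local v)]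
      [∀ γ : ((UnitaryGroup.cmDatum L 3 (Matrix.of fun i j : Fin 3 => if i.val + j.val + 1 = 3 then (1 : L) else 0)).Local v), MeasurableSpace (((UnitaryGroup.cmDatum L 3 (Matrix.of fun i j : Fin 3 => if i.val + j.val + 1 = 3 then (1 : L) else 0)).Local v) ⧸ Subgroup.centralizer ({γ} : Set ((UnitaryGroup.cmDatum L 3 (Matrix.of fun i j : Fin 3 => if i.val + j.val + 1 = 3 then (1 : L) else 0)).Local v)))]
      [∀ γ : ((UnitaryGroup.cmDatum L 3 (Matrix.of fun i j : Fin 3 => if i.val + j.val + 1 = 3 then (1 : L) else 0)).Local v), BorelSpace (((UnitaryGroup.cmDatum L 3 (Matrix.of fun i j : Fin 3 => if i.val + j.val + 1 = 3 then (1 : L) else 0)).Local v) ⧸ Subgroup.centralizer ({γ} : Set ((UnitaryGroup.cmDatum L 3 (Matrix.of fun i j : Fin 3 => if i.val + j.val + 1 = 3 then (1 : L) else 0)).Local v)))]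
      [MeasurableSpace ((UnitaryGroup.cmDatum L 2 (Matrix.of fun i j : Fin 2 => if i.val + j.val + 1 = 2 then (1 : L) else 0)).Local v × (UnitaryGroup.cmDatum L 1 (Matrix.of fun i j : Fin 1 => if i.val + j.val + 1 = 1 then (1 : L) else 0)).Local v)] [BorelSpace ((UnitaryGroup.cmDatum L 2 (Matrix.of fun i j : Fin 2 => if i.val + j.val + 1 = 2 then (1 : L) else 0)).Local v × (UnitaryGroup.cmDatum L 1 (Matrix.of fun i j : Fin 1 => if i.val + j.val + 1 = 1 then (1 : L) else 0)).Local v)]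
      [∀ a : ((UnitaryGroup.cmDatum L 2 (Matrix.of fun i j : Fin 2 => if i.val + j.val + 1 = 2 then (1 : L) else 0)).Local v × (UnitaryGroup.cmDatum L 1 (Matrix.of fun i j : Fin 1 => if i.val + j.val + 1 = 1 then (1 : L) else 0)).Local v), MeasurableSpace (((UnitaryGroup.cmDatum L 2 (Matrix.of fun i j : Fin 2 => if i.val + j.val + 1 = 2 then (1 : L) else 0)).Local v × (UnitaryGroup.cmDatum L 1 (Matrix.of fun i j : Fin 1 => if i.val + j.val + 1 = 1 then (1 : L) else 0)).Local v) ⧸ Subgroup.centralizer ({a} : Set ((UnitaryGroup.cmDatum L 2 (Matrix.of fun i j : Fin 2 => if i.val + j.val + 1 = 2 then (1 : L) else 0)).Local v × (UnitaryGroup.cmDatum L 1 (Matrix.of fun i j : Fin 1 => if i.val + j.val + 1 = 1 then (1 : L) else 0)).Local v)))]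
      [∀ a : ((UnitaryGroup.cmDatum L 2 (Matrix.of fun i j : Fin 2 => if i.val + j.val + 1 = 2 then (1 : L) else 0)).Local v × (UnitaryGroup.cmDatum L 1 (Matrix.of fun i j : Fin 1 => if i.val + j.val + 1 = 1 then (1 : L) else 0)).Local v), BorelSpace (((UnitaryGroup.cmDatum L 2 (Matrix.of fun i j : Fin 2 => if i.val + j.val + 1 = 2 then (1 : L) else 0)).Local v × (UnitaryGroup.cmDatum L 1 (Matrix.of fun i j : Fin 1 => if i.val + j.val + 1 = 1 then (1 : L) else 0)).Local v) ⧸ Subgroup.centralizer ({a} : Set ((UnitaryGroup.cmDatum L 2 (Matrix.of fun i j : Fin 2 => if i.val + j.val + 1 = 2 then (1 : L) else 0)).Local v × (UnitaryGroup.cmDatum L 1 (Matrix.of fun i j : Fin 1 => if i.val + j.val + 1 = 1 then (1 : L) else 0)).Local v)))]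
      (νH : Measure ((UnitaryGroup.cmDatum L 2 (Matrix.of fun i j : Fin 2 => if i.val + j.val + 1 = 2 then (1 : L) else 0)).Local v × (UnitaryGroup.cmDatum L 1 (Matrix.of fun i j : Fin 1 => if i.val + j.val + 1 = 1 then (1 : L) else 0)).Local v)) [νH.IsHaarMeasure] [νH.IsMulRightInvariant]
      (νG₃ : Measure ((UnitaryGroup.cmDatum L 3 (Matrix.of fun i j : Fin 3 => if i.val + j.val + 1 = 3 then (1 : L) else 0)).Local v)) [νG₃.IsHaarMeasure] [νG₃.IsMulRightInvariant]
      {mH : OrbitalMeasureFamily ((UnitaryGroup.cmDatum L 2 (Matrix.of fun i j : Fin 2 => if i.val + j.val + 1 = 2 then (1 : L) else 0)).Local v × (UnitaryGroup.cmDatum L 1 (Matrix.of fun i j : Fin 1 => if i.val + j.val + 1 = 1 then (1 : L) else 0)).Local v)} {mG₃ : OrbitalMeasureFamily ((UnitaryGroup.cmDatum L 3 (Matrix.of fun i j : Fin 3 => if i.val + j.val + 1 = 3 then (1 : L) else 0)).Local v)},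
      mH.IsCanonical (IsLocalGRegular L v) νH → mG₃.IsCanonical (fun γ => IsRegularElt (γ.val : GL (Fin 3) (UnitaryGroup.LocalRing L v))) νG₃ →
      ∀ (φ₃ : ((UnitaryGroup.cmDatum L 3 (Matrix.of fun i j : Fin 3 => if i.val + j.val + 1 = 3 then (1 : L) else 0)).Local v) → ℂ), IsLocSmooth φ₃ →
        ∃ V ∈ 𝓝 (1 : ((UnitaryGroup.cmDatum L 2 (Matrix.of fun i j : Fin 2 => if i.val + j.val + 1 = 2 then (1 : L) else 0)).Local v × (UnitaryGroup.cmDatum L 1 (Matrix.of fun i j : Fin 1 => if i.val + j.val + 1 = 1 then (1 : L) else 0)).Local v)), ∃ φH : ((UnitaryGroup.cmDatum L 2 (Matrix.of fun i j : Fin 2 => if i.val + j.val + 1 = 2 then (1 : L) else 0)).Local v × (UnitaryGroup.cmDatum L 1 (Matrix.of fun i j : Fin 1 => if i.val + j.val + 1 = 1 then (1 : L) else 0)).Local v) → ℂ, IsLocSmooth φH ∧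
          ∀ γH ∈ V, IsLocalGRegular L v γH →
            stableOrbitalIntegralRel (IsLocalStablyConjH L v) mH φH γH =
              ∑ᶠ c : ConjClasses ((UnitaryGroup.cmDatum L 3 (Matrix.of fun i j : Fin 3 => if i.val + j.val + 1 = 3 then (1 : L) else 0)).Local v), ((finExplicitCollection L (Matrix.of fun i j : Fin 3 => if i.val + j.val + 1 = 3 then (1 : L) else 0) μ (finExplicitDelta_conj_left_all L (Matrix.of fun i j : Fin 3 => if i.val + j.val + 1 = 3 then (1 : L) else 0) μ) (finExplicitDelta_conj_right_all L (Matrix.of fun i j : Fin 3 => if i.val + j.val + 1 = 3 then (1 : L) else 0) μ)) v).Δ γH (Quotient.out c) * classOrbitalIntegral mG₃ φ₃ c) :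
    N6nsDyadicStatement := by
  intro L _ _ _ H' μ _ _ _ _ νH νG _ _ _ _ hμu hμω hH' hanis v hsub h2 _iH _bH _iG _bG mH mG hmH hmG φ hφ
  -- the place `w ∣ v`, `c • w = w`, `det H′ ≠ 0`
  obtain ⟨w⟩ : Nonempty (UnitaryGroup.PlacesOver L v) := inferInstance
  have hw : IsCMField.complexConj L • w.1 = w.1 := smul_placesOver_eq_of_subsingleton L v (IsCMField.complexConj L) hsub w
  have hdet : H'.det ≠ 0 := Godement.det_ne_zero_of_anisotropic L H' hanis
  -- the frame at the non-split place (★ (H2), parity-free) and the DESCENT (★ `s3id_descent_of_formCongr`, parity-free)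
  obtain ⟨T, a, ha, haσ, h⟩ := HermitianFrame.exists_formCongr_conjLocal_eq_smul_antidiag_three L H' hH' hdet w hw
  refine s3id_descent_of_formCongr L H' μ hH' hdet w hw (νG v) mH hmG T ha haσ h ?_ φ hφ
  intro _ _ _ _ νG₃ _ _ mG₃ hmG₃ φ₃ hφ₃
  -- «DYADIC AT `Φ₃`» at `(L, μ, w)`, the dyadic hypothesis read at `w`
  exact hdyΦ₃ L μ w hw hμu hμω (h2 w) (νH v) νG₃ hmH hmG₃ φ₃ hφ₃

end Literature.NumberTheory.Rogawski1990

end
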